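import Mathlib.Geometry.Manifold.IntegralCurve.UniformTime
import Mathlib.Geometry.Manifold.VectorBundle.Basic
import Mathlib.Geometry.Manifold.ContMDiff.Constructions
import Literature.Analysis.ODE.FlowDomain
import Literature.Topology.FourManifolds.Flows
import HarnessLib

/-!
# The flow of a smooth vector field on a compact manifold without boundary: discharge of
# `Literature.Topology.FourManifolds.exists_contMDiff_globalFlow`

Topic `Literature/Topology/FourManifolds` (fact seat
`provefact-Literature.SPC4.exists_isMorse_isSelfIndexing`; sibling proofs file of `Flows.lean`, which
states the *fundamental theorem on flows* for compact manifolds without boundary, Lee,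
*Introduction to Smooth Manifolds* (2012), Thm. 9.12 with Thm. 9.16 / Cor. 9.17, as the named
fact `Literature.Topology.FourManifolds.exists_contMDiff_globalFlow`).  Everything here is **proved**; the main results:

* `Literature.Topology.FourManifolds.exists_contMDiffOn_localFlow` — about an interior point of a `C^∞` manifold (any real
  Banach model, any model with corners) a smooth vector field has a *smooth local flow*: an
  open `U ∋ x₀`, `ε > 0` and `Φ` with `Φ x` an integral curve on `(-ε, ε)` through each `x ∈ U`
  and `(x, t) ↦ Φ x t` smooth on `U × (-ε, ε)`.  The field is read in the extended chart at
  `x₀` (its coordinates are smooth on the chart domain: `Literature.Topology.FourManifolds.contMDiffOn_tangentCoordChange_apply`,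
  smoothness of a section in the trivialisation of `TM`), the smooth local flow of that field on
  the open set `interior (chart target)` is the tree's **smooth dependence on initial
  conditions** (`Literature.Analysis.ODE.exists_contDiffOn_flow`, `Literature/Analysis/ODE/`, Lang (1995),
  Ch. IV §1, Thm. 1.14), and its curves are integral curves of the field by the computation of
  Mathlib's `exists_isMIntegralCurveAt_of_contMDiffAt`;
* on a **compact** Hausdorff manifold all of whose points are interior
  (`BoundarylessManifold I M` — the model itself may have boundary, so that the total space of a
  cobordism with empty ends qualifies): a uniform time of existence
  (`Literature.Topology.FourManifolds.exists_uniform_localFlow`), **completeness** (`Literature.Topology.FourManifolds.exists_isMIntegralCurve_of_compactSpace`,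
  Lee's Lemma 9.15 being Mathlib's `exists_isMIntegralCurve_of_isMIntegralCurveOn`), the **flow**
  `Literature.flow hV x : ℝ → M` (the integral curve through `x`, by choice) with `flow_zero`,
  `isMIntegralCurve_flow`, uniqueness (`eq_flow_of_isMIntegralCurve`,
  `eqOn_flow_of_isMIntegralCurveOn`), the group law `flow_add` and `flow_neg_flow`, and
  **joint smoothness** `Literature.Topology.FourManifolds.contMDiff_flow` (locally the flow is the smooth local flow; every
  time-`t` map is an iterate of short-time maps, `contMDiff_flow_apply`; and
  `flow (x, t) = flow (flow (x, t₁), t - t₁)`), packaged as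
  `Literature.Topology.FourManifolds.exists_contMDiff_globalFlow_of_boundarylessManifold`;
* `Literature.exists_contMDiff_globalFlow_holds : exists_contMDiff_globalFlow` — **the discharge of
  the named fact** (boundaryless model, finite-dimensional hence complete model space).

## References

* J. M. Lee, *Introduction to Smooth Manifolds*, 2nd ed., GTM 218 (2012), Prop. 9.2, Thm. 9.12
  (fundamental theorem on flows), Lemma 9.15, Thm. 9.16, Cor. 9.17. [LeeSmoothManifolds2013]
* S. Lang, *Differential and Riemannian Manifolds*, GTM 160 (1995), Ch. IV §1, Thms. 1.14–1.16
  (the tree's `Literature/Analysis/ODE/SmoothDependence.lean`, `FlowDomain.lean`). [Lang1995]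
-/

open scoped Manifold ContDiff Topology
open Set Function Filter Metric

noncomputable section

namespace Literature.Topology.FourManifolds

universe u

/-! ### Local flows in a chart -/

section LocalFlow

variable {E : Type u} [NormedAddCommGroup E] [NormedSpace ℝ E] [CompleteSpace E]
  {H : Type*} [TopologicalSpace H] {I : ModelWithCorners ℝ E H}
  {M : Type*} [TopologicalSpace M] [ChartedSpace H M] [IsManifold I ∞ M]
  {V : Π x : M, TangentSpace I x}

omit [CompleteSpace E] in
/-- The coordinates, in the chart at `x₀`, of a smooth vector field form a function which is
smooth on the chart domain (smoothness of a section read in the trivialisation of the tangent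
bundle over the chart at `x₀`). [folklore] -/
theorem contMDiffOn_tangentCoordChange_apply
    (hV : ContMDiff I I.tangent ∞ fun x => (⟨x, V x⟩ : TangentBundle I M)) (x₀ : M) :
    ContMDiffOn I 𝓘(ℝ, E) ∞ (fun x => tangentCoordChange I x x₀ x (V x)) (chartAt H x₀).source := by
  have h := (Bundle.Trivialization.contMDiffOn_section_baseSet_iff (IB := I) (n := ∞) (F := E)
    (E := TangentSpace I) (s := V) (trivializationAt E (TangentSpace I) x₀)).1
    (by rw [TangentBundle.trivializationAt_baseSet]; exact hV.contMDiffOn)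
  rw [TangentBundle.trivializationAt_baseSet] at h
  refine h.congr fun x _ => ?_
  rw [TangentBundle.trivializationAt_apply, tangentCoordChange_def]
  rfl

-- as in Mathlib's `exists_isMIntegralCurveAt_of_contMDiffAt`: the tangent spaces are the
-- model space `E` by definition, which the derivative lemmas must see through
set_option backward.isDefEq.respectTransparency false in
/-- **Local flow of a smooth vector field about an interior point.**  For a smooth vector
field `V` on a `C^∞` manifold (over a complete real model space) and an interior point `x₀`,
there are an open neighbourhood `U` of `x₀`, `ε > 0` and a map `Φ : M → ℝ → M` such that for
every `x ∈ U` the curve `Φ x` is an integral curve of `V` on `(-ε, ε)` starting at `x`, and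
`(x, t) ↦ Φ x t` is smooth on `U × (-ε, ε)`.  Proof: read `V` in the extended chart `φ` at `x₀`
(a smooth field `w` on the open set `interior φ.target`), take the smooth local flow `ψ` of
`w` there (Lang (1995), Ch. IV §1, Thm. 1.14: `Literature.Analysis.ODE.exists_contDiffOn_flow`), and set
`Φ x t = φ⁻¹ (ψ (φ x) t)`; that these are integral curves of `V` is the computation of Mathlib's
`exists_isMIntegralCurveAt_of_contMDiffAt` (Lee (2012), Prop. 9.2). [cite: LeeSmoothManifolds2013, Thm. 9.12 (proof: local flows in charts)] -/
theorem exists_contMDiffOn_localFlow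
    (hV : ContMDiff I I.tangent ∞ fun x => (⟨x, V x⟩ : TangentBundle I M)) {x₀ : M}
    (hx₀ : I.IsInteriorPoint x₀) :
    ∃ U : Set M, IsOpen U ∧ x₀ ∈ U ∧ ∃ ε > (0 : ℝ), ∃ Φ : M → ℝ → M,
      (∀ x ∈ U, Φ x 0 = x) ∧ (∀ x ∈ U, IsMIntegralCurveOn (Φ x) V (Ioo (-ε) ε)) ∧
      ContMDiffOn (I.prod 𝓘(ℝ, ℝ)) I ∞ (fun p : M × ℝ => Φ p.1 p.2) (U ×ˢ Ioo (-ε) ε) := by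
  set φ := extChartAt I x₀ with hφ
  set O : Set E := interior φ.target with hO
  have hOo : IsOpen O := isOpen_interior
  have hOsub : O ⊆ φ.target := interior_subset
  have hx₀' : φ x₀ ∈ O := I.isInteriorPoint_iff.1 hx₀
  -- the field in the chart
  set W : M → E := fun x => tangentCoordChange I x x₀ x (V x) with hW
  have hWs : ContMDiffOn I 𝓘(ℝ, E) ∞ W (chartAt H x₀).source :=
    contMDiffOn_tangentCoordChange_apply hV x₀
  set w : E → E := W ∘ φ.symm with hw
  have hwO : ContDiffOn ℝ ∞ w O := by
    have h1 : ContMDiffOn 𝓘(ℝ, E) 𝓘(ℝ, E) ∞ w φ.target :=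
      hWs.comp (contMDiffOn_extChartAt_symm x₀) fun y hy => by
        rw [← extChartAt_source I]; exact φ.map_target hy
    exact (contMDiffOn_iff_contDiffOn.1 h1).mono interior_subset
  -- the local flow in the chart
  obtain ⟨ψ, r, hr, ε, hε, hψ0, hψd, hψO, hψs⟩ :=
    Literature.Analysis.ODE.exists_contDiffOn_flow (n := (⊤ : ℕ∞)) hOo hwO le_top hx₀'
  set U : Set M := φ.source ∩ φ ⁻¹' ball (φ x₀) r with hU
  have hUo : IsOpen U := isOpen_extChartAt_preimage' x₀ isOpen_ball
  have hx₀U : x₀ ∈ U := ⟨mem_extChartAt_source x₀, mem_ball_self hr⟩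
  set Φ : M → ℝ → M := fun x t => φ.symm (ψ (φ x) t) with hΦ
  refine ⟨U, hUo, hx₀U, ε, hε, Φ, fun x hx => ?_, fun x hx t ht => ?_, ?_⟩
  · -- initial condition
    simp only [hΦ, hψ0 (φ x) hx.2, φ.left_inv hx.1]
  · -- integral curves (as in Mathlib's `exists_isMIntegralCurveAt_of_contMDiffAt`)
    have hf3 : ψ (φ x) t ∈ interior φ.target := hψO (φ x) hx.2 t ht
    have hf3' : ψ (φ x) t ∈ φ.target := hOsub hf3
    set xₜ : M := φ.symm (ψ (φ x) t) with hxₜ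
    have h : HasDerivAt (ψ (φ x)) (tangentCoordChange I xₜ x₀ xₜ (V xₜ)) t := hψd (φ x) hx.2 t ht
    have hft1 : xₜ ∈ (extChartAt I x₀).source := φ.map_target hf3'
    have hft2 := mem_extChartAt_source (I := I) xₜ
    apply HasMFDerivAt.hasMFDerivWithinAt
    refine ⟨(continuousAt_extChartAt_symm'' hf3').comp h.continuousAt,
      HasDerivWithinAt.hasFDerivWithinAt ?_⟩
    simp only [mfld_simps, hasDerivWithinAt_univ]
    change HasDerivAt ((extChartAt I xₜ ∘ (extChartAt I x₀).symm) ∘ ψ (φ x)) (V xₜ) t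
    rw [← tangentCoordChange_self (I := I) (x := xₜ) (z := xₜ) (v := V xₜ) hft2,
      ← tangentCoordChange_comp (x := x₀) ⟨⟨hft2, hft1⟩, hft2⟩]
    apply HasFDerivAt.comp_hasDerivAt _ _ h
    apply HasFDerivWithinAt.hasFDerivAt (s := range I) _ <|
      mem_nhds_iff.mpr ⟨interior (extChartAt I x₀).target,
        subset_trans interior_subset (extChartAt_target_subset_range ..),
        isOpen_interior, hf3⟩
    rw [← (extChartAt I x₀).right_inv hf3']
    exact hasFDerivWithinAt_tangentCoordChange ⟨hft1, hft2⟩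
  · -- smoothness of `(x, t) ↦ φ⁻¹ (ψ (φ x) t)`
    have h1 : ContMDiffOn (I.prod 𝓘(ℝ, ℝ)) 𝓘(ℝ, E × ℝ) ∞ (fun p : M × ℝ => (φ p.1, p.2))
        (U ×ˢ Ioo (-ε) ε) := by
      refine ContMDiffOn.prodMk_space ?_ contMDiffOn_snd
      exact (contMDiffOn_extChartAt (x := x₀)).comp contMDiffOn_fst fun p hp => by
        rw [← extChartAt_source I]; exact hp.1.1
    have h2 : ContMDiffOn 𝓘(ℝ, E × ℝ) 𝓘(ℝ, E) ∞ (fun q : E × ℝ => ψ q.1 q.2)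
        (ball (φ x₀) r ×ˢ Ioo (-ε) ε) := contMDiffOn_iff_contDiffOn.2 hψs
    have h3 : ContMDiffOn 𝓘(ℝ, E) I ∞ φ.symm φ.target := contMDiffOn_extChartAt_symm x₀
    have h23 : ContMDiffOn 𝓘(ℝ, E × ℝ) I ∞ (fun q : E × ℝ => φ.symm (ψ q.1 q.2))
        (ball (φ x₀) r ×ˢ Ioo (-ε) ε) :=
      h3.comp h2 fun q hq => hOsub (hψO q.1 hq.1 q.2 hq.2)
    exact h23.comp h1 fun p hp => ⟨hp.1.2, hp.2⟩

end LocalFlow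

/-! ### Compact manifolds without boundary: completeness and the global flow -/

section Compact

variable {E : Type u} [NormedAddCommGroup E] [NormedSpace ℝ E] [CompleteSpace E]
  {H : Type*} [TopologicalSpace H] {I : ModelWithCorners ℝ E H}
  {M : Type*} [TopologicalSpace M] [ChartedSpace H M] [IsManifold I ∞ M]
  [T2Space M] [CompactSpace M] [BoundarylessManifold I M]
  {V : Π x : M, TangentSpace I x}

omit [T2Space M] in
/-- **Uniform local flows on a compact manifold without boundary**: there is `ε > 0` such that
every point has a neighbourhood `U` and a smooth local flow on `U × (-ε, ε)` (finitely many of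
the local flows of `exists_contMDiffOn_localFlow` cover `M`; Lee (2012), proof of Thm. 9.16 /
Lemma 9.15). [cite: LeeSmoothManifolds2013, Lemma 9.15 and Thm. 9.16] -/
theorem exists_uniform_localFlow
    (hV : ContMDiff I I.tangent ∞ fun x => (⟨x, V x⟩ : TangentBundle I M)) :
    ∃ ε > (0 : ℝ), ∀ x₀ : M, ∃ U : Set M, IsOpen U ∧ x₀ ∈ U ∧ ∃ Φ : M → ℝ → M,
      (∀ x ∈ U, Φ x 0 = x) ∧ (∀ x ∈ U, IsMIntegralCurveOn (Φ x) V (Ioo (-ε) ε)) ∧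
      ContMDiffOn (I.prod 𝓘(ℝ, ℝ)) I ∞ (fun p : M × ℝ => Φ p.1 p.2) (U ×ˢ Ioo (-ε) ε) := by
  classical
  have hloc : ∀ x₀ : M, ∃ U : Set M, IsOpen U ∧ x₀ ∈ U ∧ ∃ ε > (0 : ℝ), ∃ Φ : M → ℝ → M,
      (∀ x ∈ U, Φ x 0 = x) ∧ (∀ x ∈ U, IsMIntegralCurveOn (Φ x) V (Ioo (-ε) ε)) ∧
      ContMDiffOn (I.prod 𝓘(ℝ, ℝ)) I ∞ (fun p : M × ℝ => Φ p.1 p.2) (U ×ˢ Ioo (-ε) ε) :=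
    fun x₀ => exists_contMDiffOn_localFlow hV BoundarylessManifold.isInteriorPoint
  choose U hUo hxU ε hε Φ hΦ0 hΦc hΦs using hloc
  obtain ⟨T, hT⟩ := isCompact_univ.elim_finite_subcover U hUo fun x _ => mem_iUnion.2 ⟨x, hxU x⟩
  rcases isEmpty_or_nonempty M with hM | hM
  · exact ⟨1, one_pos, fun x₀ => (IsEmpty.false x₀).elim⟩
  have hTne : T.Nonempty := by
    obtain ⟨x⟩ := hM
    obtain ⟨i, hi, -⟩ := mem_iUnion₂.1 (hT (mem_univ x))
    exact ⟨i, hi⟩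
  refine ⟨T.inf' hTne ε, (Finset.lt_inf'_iff hTne).2 fun i _ => hε i, fun x₀ => ?_⟩
  obtain ⟨i, hi, hx₀i⟩ := mem_iUnion₂.1 (hT (mem_univ x₀))
  have hIoo : Ioo (-(T.inf' hTne ε)) (T.inf' hTne ε) ⊆ Ioo (-ε i) (ε i) := fun t ht =>
    ⟨lt_of_le_of_lt (neg_le_neg (Finset.inf'_le _ hi)) ht.1, lt_of_lt_of_le ht.2 (Finset.inf'_le _ hi)⟩
  exact ⟨U i, hUo i, hx₀i, Φ i, hΦ0 i, fun x hx => (hΦc i x hx).mono hIoo,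
    (hΦs i).mono (prod_mono Subset.rfl hIoo)⟩

/-- **Completeness of vector fields on compact manifolds without boundary** (Lee (2012),
Thm. 9.16 / Cor. 9.17: *"On a compact smooth manifold, every smooth vector field is
complete"*): every point lies on an integral curve defined on all of `ℝ` (uniform time of
existence, then Mathlib's `exists_isMIntegralCurve_of_isMIntegralCurveOn`, Lee's Lemma 9.15). [cite: LeeSmoothManifolds2013, Thm. 9.16 and Cor. 9.17] -/
theorem exists_isMIntegralCurve_of_compactSpace
    (hV : ContMDiff I I.tangent ∞ fun x => (⟨x, V x⟩ : TangentBundle I M)) (x : M) :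
    ∃ γ : ℝ → M, γ 0 = x ∧ IsMIntegralCurve γ V := by
  obtain ⟨ε, hε, hloc⟩ := exists_uniform_localFlow hV
  refine exists_isMIntegralCurve_of_isMIntegralCurveOn (hV.of_le (by norm_cast)) hε
    (fun y => ?_) x
  obtain ⟨U, -, hyU, Φ, hΦ0, hΦc, -⟩ := hloc y
  exact ⟨Φ y, hΦ0 y hyU, hΦc y hyU⟩

/-- **The flow** of a smooth vector field on a compact manifold without boundary: `flow hV x`
is the (unique) integral curve of `V` on `ℝ` with `flow hV x 0 = x` (a definition by choice
from `exists_isMIntegralCurve_of_compactSpace`; Lee (2012), Thm. 9.12). [cite: LeeSmoothManifolds2013, Thm. 9.12] -/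
def flow (hV : ContMDiff I I.tangent ∞ fun x => (⟨x, V x⟩ : TangentBundle I M)) (x : M) : ℝ → M :=
  Classical.choose (exists_isMIntegralCurve_of_compactSpace hV x)

/-- The flow starts at the given point. [cite: LeeSmoothManifolds2013, Thm. 9.12] -/
@[simp]
theorem flow_zero (hV : ContMDiff I I.tangent ∞ fun x => (⟨x, V x⟩ : TangentBundle I M)) (x : M) :
    flow hV x 0 = x :=
  (Classical.choose_spec (exists_isMIntegralCurve_of_compactSpace hV x)).1

/-- Each curve of the flow is an integral curve of `V` on `ℝ`. [cite: LeeSmoothManifolds2013, Thm. 9.12] -/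
theorem isMIntegralCurve_flow (hV : ContMDiff I I.tangent ∞ fun x => (⟨x, V x⟩ : TangentBundle I M))
    (x : M) : IsMIntegralCurve (flow hV x) V :=
  (Classical.choose_spec (exists_isMIntegralCurve_of_compactSpace hV x)).2

/-- **Uniqueness**: every integral curve of `V` on `ℝ` is a curve of the flow. [cite: LeeSmoothManifolds2013, Thm. 9.12 (a)] -/
theorem eq_flow_of_isMIntegralCurve
    (hV : ContMDiff I I.tangent ∞ fun x => (⟨x, V x⟩ : TangentBundle I M)) {γ : ℝ → M}
    (hγ : IsMIntegralCurve γ V) : γ = flow hV (γ 0) :=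
  isMIntegralCurve_Ioo_eq_of_contMDiff_boundaryless (t₀ := 0) (hV.of_le (by norm_cast)) hγ
    (isMIntegralCurve_flow hV _) (by rw [flow_zero])

/-- Integral curves on an open interval through `0` agree there with the flow. [cite: LeeSmoothManifolds2013, Thm. 9.12 (a)] -/
theorem eqOn_flow_of_isMIntegralCurveOn
    (hV : ContMDiff I I.tangent ∞ fun x => (⟨x, V x⟩ : TangentBundle I M)) {γ : ℝ → M} {a b : ℝ}
    (h0 : (0 : ℝ) ∈ Ioo a b) (hγ : IsMIntegralCurveOn γ V (Ioo a b)) :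
    EqOn γ (flow hV (γ 0)) (Ioo a b) :=
  isMIntegralCurveOn_Ioo_eqOn_of_contMDiff_boundaryless h0 (hV.of_le (by norm_cast)) hγ
    ((isMIntegralCurve_flow hV _).isMIntegralCurveOn _) (by rw [flow_zero])

/-- **The group law** `flow (s + t) = flow t ∘ flow s` (Lee (2012), Thm. 9.12; by uniqueness
of integral curves). [cite: LeeSmoothManifolds2013, Thm. 9.12] -/
theorem flow_add (hV : ContMDiff I I.tangent ∞ fun x => (⟨x, V x⟩ : TangentBundle I M)) (x : M)
    (s t : ℝ) : flow hV x (s + t) = flow hV (flow hV x s) t := by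
  have hγ : IsMIntegralCurve (fun t => flow hV x (t + s)) V := (isMIntegralCurve_flow hV x).comp_add s
  have h := congrFun (eq_flow_of_isMIntegralCurve hV hγ) t
  rw [add_comm s t]
  simpa only [zero_add] using h

/-- `flow (-t)` undoes `flow t`. [cite: LeeSmoothManifolds2013, Thm. 9.12] -/
theorem flow_neg_flow (hV : ContMDiff I I.tangent ∞ fun x => (⟨x, V x⟩ : TangentBundle I M))
    (x : M) (t : ℝ) : flow hV (flow hV x t) (-t) = x := by
  rw [← flow_add, add_neg_cancel, flow_zero]

/-- Near every point and for short times, the flow is smooth jointly in `(x, t)` (it agrees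
with the smooth local flows by uniqueness); the time bound is uniform over the compact
manifold. [cite: LeeSmoothManifolds2013, Thm. 9.12 (proof)] -/
theorem exists_forall_contMDiffOn_flow
    (hV : ContMDiff I I.tangent ∞ fun x => (⟨x, V x⟩ : TangentBundle I M)) :
    ∃ ε > (0 : ℝ), ∀ x₀ : M, ∃ U : Set M, IsOpen U ∧ x₀ ∈ U ∧
      ContMDiffOn (I.prod 𝓘(ℝ, ℝ)) I ∞ (fun p : M × ℝ => flow hV p.1 p.2) (U ×ˢ Ioo (-ε) ε) := by
  obtain ⟨ε, hε, hloc⟩ := exists_uniform_localFlow hV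
  refine ⟨ε, hε, fun x₀ => ?_⟩
  obtain ⟨U, hUo, hx₀U, Φ, hΦ0, hΦc, hΦs⟩ := hloc x₀
  refine ⟨U, hUo, hx₀U, hΦs.congr ?_⟩
  rintro ⟨x, t⟩ ⟨hx, ht⟩
  have h0 : (0 : ℝ) ∈ Ioo (-ε) ε := ⟨by linarith, hε⟩
  have h := eqOn_flow_of_isMIntegralCurveOn hV h0 (hΦc x hx) ht
  simp only [hΦ0 x hx] at h
  exact h.symm

/-- For short times `t`, the time-`t` map of the flow is smooth. [cite: LeeSmoothManifolds2013, Thm. 9.12 (proof)] -/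
theorem contMDiff_flow_of_abs_lt
    (hV : ContMDiff I I.tangent ∞ fun x => (⟨x, V x⟩ : TangentBundle I M)) {ε : ℝ}
    (hε : ∀ x₀ : M, ∃ U : Set M, IsOpen U ∧ x₀ ∈ U ∧
      ContMDiffOn (I.prod 𝓘(ℝ, ℝ)) I ∞ (fun p : M × ℝ => flow hV p.1 p.2) (U ×ˢ Ioo (-ε) ε))
    {t : ℝ} (ht : t ∈ Ioo (-ε) ε) : ContMDiff I I ∞ fun x => flow hV x t := by
  intro x₀
  obtain ⟨U, hUo, hx₀U, hs⟩ := hε x₀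
  have h1 : ContMDiffAt (I.prod 𝓘(ℝ, ℝ)) I ∞ (fun p : M × ℝ => flow hV p.1 p.2) (x₀, t) :=
    (hs _ ⟨hx₀U, ht⟩).contMDiffAt ((hUo.prod isOpen_Ioo).mem_nhds ⟨hx₀U, ht⟩)
  exact h1.comp x₀ (contMDiffAt_id.prodMk contMDiffAt_const)

/-- Every time-`t` map of the flow is smooth: `flow t = (flow (t/m))^m` with `t/m` short. [cite: LeeSmoothManifolds2013, Thm. 9.12 (proof)] -/
theorem contMDiff_flow_apply
    (hV : ContMDiff I I.tangent ∞ fun x => (⟨x, V x⟩ : TangentBundle I M)) (t : ℝ) :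
    ContMDiff I I ∞ fun x => flow hV x t := by
  obtain ⟨ε, hε, hloc⟩ := exists_forall_contMDiffOn_flow hV
  -- number of steps
  obtain ⟨m, hm⟩ : ∃ m : ℕ, |t| / ε < m := exists_nat_gt _
  have hm0' : (0 : ℝ) < m := lt_of_le_of_lt (by positivity) hm
  have hm0 : 0 < m := Nat.cast_pos.1 hm0'
  have hsmall : t / m ∈ Ioo (-ε) ε := by
    rw [div_lt_iff₀ hε] at hm
    have h : |t / m| < ε := by
      rw [abs_div, abs_of_pos hm0', div_lt_iff₀ hm0']; linarith
    exact ⟨(abs_lt.1 h).1, (abs_lt.1 h).2⟩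
  have hstep : ContMDiff I I ∞ fun x => flow hV x (t / m) := contMDiff_flow_of_abs_lt hV hloc hsmall
  -- iterate
  have hiter : ∀ k : ℕ, ContMDiff I I ∞ fun x => flow hV x (k * (t / m)) := by
    intro k
    induction k with
    | zero => simp only [Nat.cast_zero, zero_mul, flow_zero]; exact contMDiff_id
    | succ k ih =>
      have heq : (fun x => flow hV x ((k + 1 : ℕ) * (t / m))) =
          (fun x => flow hV x (t / m)) ∘ fun x => flow hV x (k * (t / m)) := by
        funext x
        simp only [comp_apply, ← flow_add]
        congr 1; push_cast; ring
      rw [heq]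
      exact hstep.comp ih
  have h := hiter m
  have hmt : (m : ℝ) * (t / m) = t := mul_div_cancel₀ t hm0'.ne'
  simpa only [hmt] using h

/-- **The flow is smooth jointly in time and position** (Lee (2012), Thm. 9.12: the flow of a
smooth vector field is smooth on its (here: full) domain):
`flow (x, t) = flow (flow (x, t₁), t - t₁)` with `t - t₁` short. [cite: LeeSmoothManifolds2013, Thm. 9.12] -/
theorem contMDiff_flow (hV : ContMDiff I I.tangent ∞ fun x => (⟨x, V x⟩ : TangentBundle I M)) :
    ContMDiff (𝓘(ℝ, ℝ).prod I) I ∞ fun p : ℝ × M => flow hV p.2 p.1 := by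
  obtain ⟨ε, hε, hloc⟩ := exists_forall_contMDiffOn_flow hV
  rintro ⟨t₁, x₁⟩
  -- near `(t₁, x₁)`: `flow x t = flow (flow x t₁) (t - t₁)`
  have heq : (fun p : ℝ × M => flow hV p.2 p.1) =
      (fun q : M × ℝ => flow hV q.1 q.2) ∘ fun p : ℝ × M => (flow hV p.2 t₁, p.1 - t₁) := by
    funext p
    simp only [comp_apply, ← flow_add, add_sub_cancel]
  rw [heq]
  obtain ⟨U, hUo, hyU, hs⟩ := hloc (flow hV x₁ t₁)
  have h0 : (0 : ℝ) ∈ Ioo (-ε) ε := ⟨by linarith, hε⟩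
  have h2 : ContMDiffAt (I.prod 𝓘(ℝ, ℝ)) I ∞ (fun q : M × ℝ => flow hV q.1 q.2) (flow hV x₁ t₁, t₁ - t₁) := by
    rw [sub_self]
    exact (hs _ ⟨hyU, h0⟩).contMDiffAt ((hUo.prod isOpen_Ioo).mem_nhds ⟨hyU, h0⟩)
  have h1 : ContMDiffAt (𝓘(ℝ, ℝ).prod I) (I.prod 𝓘(ℝ, ℝ)) ∞
      (fun p : ℝ × M => (flow hV p.2 t₁, p.1 - t₁)) (t₁, x₁) :=
    ((contMDiff_flow_apply hV t₁).contMDiffAt.comp (t₁, x₁) contMDiffAt_snd).prodMk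
      ((contDiff_id.sub contDiff_const).contDiffAt.comp_contMDiffAt contMDiffAt_fst)
  exact ContMDiffAt.comp (t₁, x₁) h2 h1

/-- **The fundamental theorem on flows for compact manifolds without boundary**, in the
generality of Mathlib's `BoundarylessManifold` (every point interior; the model may have
boundary): a smooth vector field on a compact Hausdorff `C^∞` manifold without boundary points
generates a global flow `θ : ℝ × M → M`, jointly smooth, with `θ(0, p) = p`,
`θ(t, θ(s, p)) = θ(t + s, p)`, whose curves are the integral curves of `V` (Lee (2012),
Thm. 9.12 with Thm. 9.16/Cor. 9.17). [cite: LeeSmoothManifolds2013, Thm. 9.12 and Cor. 9.17] -/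
theorem exists_contMDiff_globalFlow_of_boundarylessManifold
    (hV : ContMDiff I I.tangent ∞ fun x => (⟨x, V x⟩ : TangentBundle I M)) :
    ∃ θ : ℝ × M → M, ContMDiff (𝓘(ℝ, ℝ).prod I) I ∞ θ ∧
      (∀ p, θ (0, p) = p) ∧ (∀ t s p, θ (t, θ (s, p)) = θ (t + s, p)) ∧
      ∀ p, IsMIntegralCurve (fun t => θ (t, p)) V :=
  ⟨fun p => flow hV p.2 p.1, contMDiff_flow hV, fun p => flow_zero hV p,
    fun t s p => by
      show flow hV (flow hV p s) t = flow hV p (t + s)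
      rw [← flow_add, add_comm],
    fun p => isMIntegralCurve_flow hV p⟩

end Compact

/-! ### Discharge of the named fact -/

/-- **Discharge of `Literature.Topology.FourManifolds.exists_contMDiff_globalFlow`** (Lee (2012), Thm. 9.12 with Cor. 9.17:
on a compact manifold without boundary every smooth vector field generates a smooth global
flow): the case of a boundaryless *model* of the previous theorem (a finite-dimensional real
model space is complete). [cite: LeeSmoothManifolds2013, Thm. 9.12 and Cor. 9.17] -/
theorem exists_contMDiff_globalFlow_holds : exists_contMDiff_globalFlow := by
  intro E _ _ _ H _ I _ M _ _ _ _ _ _ V hV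
  haveI : CompleteSpace E := FiniteDimensional.complete ℝ E
  exact exists_contMDiff_globalFlow_of_boundarylessManifold hV

end Literature.Topology.FourManifolds
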